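import Summits.QuantumFields.BalabanUV.T4Continuum.Support.ShellMeasureRayTermsPinnedLandau

/-!
# `T4Continuum.ShellMeasureRayTermsPinnedLower` — the non-Wilson leg's LOWER-BOUND ROW `hElb₁` IS A CONSEQUENCE OF ITS
# DISPLAYED NEIGHBOURS (census R15b, one [T] hypothesis of class W-b): `−Σ_{i∈I} e_i ≤ Re Σ_{i∈I} Ef i (toPiL (Z y))`
# on the chart cube, from `hEb` and the e-tuple's located coupling `z̄ ≤ r_E∕2`
(cell `pub-balaban`, sub-cell `t4`, spine estimate NE7c (node U5b); NE7c ROUND-2 crew, unit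
`b2b-balaban-t4-ne7c-formalise-leaf-07` gen 10, own initiative on the owner's ONE-CALL census
`t4/b2b-balaban-t4-ne7c-p1/ONECALL-CENSUS-NE7c.md` v1.9 row R15b (journal OFFER of this unit); ADDITIVE — imports S71 f2
`ShellMeasureRayTermsPinnedLandau` (leaf-09-g11, p-S71 f2) ONLY (S104 f1a's three linear-map facts are re-proved in-line);
[folklore]; 0 `def`, 0 `def … : Prop`, 0 sorry, 0 citation tags)

HONEST FRAMING.  Finite four-torus programme, rung (B)+1 only — NOT infinite volume, NOT a mass gap, NOT the Clay
problem, NOT summit progress; (B), `BetaPertHyp`, (B^μ) not consumed.  NE7c (`T4IndicatorShell.ShellWeightBound`) is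
NOT PRINTED in [Balaban 1983–89] and NOT PROVED; «NE7c ⇐ the named binders» (trigger c3).  ELEMENTARY bookkeeping on OUR
side; nothing printed is asserted, cited or discharged.  HONEST DEPENDENCY (cell): continuum YM on T⁴ ⇐ BetaPertH ∧ nine
spine estimates (0/9 proved); BetaPertH ⇐ (D1) ∧ (D4) ∧ CAP+tail; G-an2-4 gates asym, D1 and NE2/3/4.

THE POINT.  Every END host since S80 f3 (`…AssembledDecay`, hence S99 f3b∕f4, S104 f2∕f4, THE ONE CALL v2∕v3∕v4 and the
histories road) carries for the e-tuple (the located non-Wilson terms, S71 f2's supplier data) the binder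
`hElb₁ : ∀ V (y : Fin m₀ → ℝ), ‖y‖ ≤ S → −BE₁ ≤ (Σ_{i∈I} Ef i (toPiL (Z_V y))).re` with a free letter `BE₁ : ℝ`
(census row R15b, class [T], W-b).  Downstream it serves ONLY the finiteness proviso of END-II (`h𝓔lb` ↦ `hfin` in
`ShellMeasureLandauPinnedEndRay` ∕ `…EndRayStokesAssembledDecay`: the density on the cube is bounded by `e^{BE₁+BE₂}`);
its SIZE never enters the slot constant.  But the SAME host also displays `hEb : ∀ i ∈ I, ∀ Z ∈ ball 0 r_E, ‖Ef i Z‖ ≤ e_i`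
and the located coupling `hcoupE : z̄_e ≤ r_E∕2` (`z̄_e = (ε₄e + B₀e·be) + B₀e·4C₂e·(ε₄e + B₀e·be)²` = the chain's bound on
`‖Z_V y‖_pin`), whose whole purpose is that the exponent field's flat image LIES IN `ball 0 (r_E∕2)` — S71 f2's own step
`hflatb` (`landauCurve_mapsTo` + `norm_toPiL_le_of_nonneg`).  At the ray parameter `σ = 1` (inside the disc `|σ| < r_Φ∕S`
because `S < r_Φ`) this gives `‖toPiL (Z_V y)‖ < r_E∕2 < r_E`, so `‖Ef i (toPiL (Z_V y))‖ ≤ e_i` and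
`Re Σ_i Ef i (…) ≥ −Σ_i ‖Ef i (…)‖ ≥ −Σ_{i∈I} e_i`.  HENCE `hElb₁` HOLDS WITH `BE₁ := Σ_{i∈I} e_i` — a consequence of
displayed rows; in a host re-fire it LEAVES (one `have`), NOTHING ENTERS (the letter `BE₁` becomes a defined sum whose size
is irrelevant).  The companion row `hElb₂` (the `T_k`-dressed integral's upper bound) is NOT of this kind: `hA`∕`hint`∕`hpos`
give ray-monotonicity, integrability and positivity, not a bound on `∫ g·e^{A(V,0,·)} dμ` — it stays displayed.
THIS FILE: **`re_sum_ge_neg_sum_of_mem_ball`** (generic: functionals bounded by `e_i` on a ball, a point in the ball ⟹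
`−Σ e_i ≤ Re Σ`), **`hElb_landau_chartRay_pinned`** (S71 f2's point∕ray binders VERBATIM minus the located-sum∕support rows,
conclusion = the hosts' `hElb₁` at `BE₁ := Σ_{i∈I} e i`, for every `‖y‖ ≤ S`), **`hElb_landau_chartRay_pinned_linear`** (the
V-indexed LINEAR-chart form of the hosts of record — `Φe := ⇑(Te V)`, `hTbe : ‖Te V‖·r_Φe < be`), `hElb_landau_chartRay_pinned_nonneg`
(`0 ≤ Σ e_i`, the old `he0`-side convenience).  EXPECTED USE (the owner labels∕books; census arithmetic is the owner's):
one `have hElb₁ := …` in the next host re-fire (S108's sweep ∕ v5), next to leaf-04-g11's `he0 hLK hBd0` (A-ne7cL04g11-1).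
HONEST: the W-b CONTENT rows `hEd hEb hblind hdepth hK` and `hElb₂ hint hpos hA` are untouched and REMAIN the wall; nothing of
Bałaban's asserted or discharged; NOTHING in the countdown moves; NE7c NOT PROVED; spine 0∕9.
-/

noncomputable section

open Set Metric Finset

namespace Summit.QuantumFields.BalabanUV.T4Continuum.ShellMeasureRayTermsPinnedLower

open Literature.MathematicalPhysics.QuantumFieldTheory.Balaban1983to89
open B11Prop6Scheme (Prop4Hyp)
open Summit.QuantumFields.BalabanUV.T4Continuum.ShellMeasureMultiGridNorms (WSup)
open Summit.QuantumFields.BalabanUV.T4Continuum.ShellMeasurePinnedNorm (pinW norm_toPiL_le_of_nonneg)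
open Summit.QuantumFields.BalabanUV.T4Continuum.ShellMeasureLandauExponent (currentData_zero)
open Summit.QuantumFields.BalabanUV.T4Continuum.ShellMeasureLandauHolonomy (solAt landauExp)
open Summit.QuantumFields.BalabanUV.T4Continuum.ShellMeasureLandauHolonomyChart (cplx ofReal_smul_cplx rayData_chart)
open Summit.QuantumFields.BalabanUV.T4Continuum.ShellMeasureLandauHolonomyTermsEnd (landauCurve_mapsTo)
open Summit.QuantumFields.BalabanUV.T4Continuum.ShellMeasureRayTermsPinnedLandau (completeSpace_wsup)

variable {Λ : Type*} [Fintype Λ] {𝔄 : Type*} [NormedAddCommGroup 𝔄] [NormedSpace ℂ 𝔄]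

/-! ## §1 Generic: a real-part lower bound from sup bounds on a ball -/

/-- **`−Σ e_i ≤ Re Σ_i f_i(Z)`** whenever each `f_i` is bounded by `e_i` on `ball 0 r` and `Z ∈ ball 0 r`:
`Re w ≥ −‖w‖` termwise. [folklore] -/
theorem re_sum_ge_neg_sum_of_mem_ball {X : Type*} [SeminormedAddCommGroup X] {𝔱 : Type*} (I : Finset 𝔱)
    {f : 𝔱 → X → ℂ} {e : 𝔱 → ℝ} {r : ℝ} (hb : ∀ i ∈ I, ∀ Z ∈ ball (0 : X) r, ‖f i Z‖ ≤ e i)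
    {Z : X} (hZ : Z ∈ ball (0 : X) r) : -(∑ i ∈ I, e i) ≤ (∑ i ∈ I, f i Z).re := by
  rw [Complex.re_sum, ← Finset.sum_neg_distrib]
  exact Finset.sum_le_sum fun i hi => (neg_le_neg (hb i hi Z hZ)).trans (abs_le.1 (Complex.abs_re_le_norm _)).1

/-! ## §2 The hosts' `hElb₁` at `BE₁ := Σ_{i∈I} e_i` from S71 f2's own ray construction -/

section ChartRay

variable [CompleteSpace 𝔄]
variable {𝒴' 𝒳 𝒵 ℬ : Type*} [NormedAddCommGroup 𝒴'] [NormedSpace ℂ 𝒴'] [NormedAddCommGroup 𝒳] [NormedSpace ℂ 𝒳]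
  [CompleteSpace 𝒳] [NormedAddCommGroup 𝒵] [NormedSpace ℂ 𝒵] [NormedAddCommGroup ℬ] [NormedSpace ℂ ℬ]
variable {n : ℕ} {δ' : ℝ} {ϖ : Λ → ℝ}

/-- **THE LOWER-BOUND ROW `hElb₁` IS A CONSEQUENCE OF `hEb` + THE LOCATED COUPLING.**  Data = S71 f2
`hE_landau_chartRay_pinned`'s point∕ray binders VERBATIM in the pinned instance `𝒴 := WSup (pinW δ′ ϖ) 1 𝔄`
((P2) `h𝒢`, (P4) `hW`, (118)∕(121) `hdom hself hcontr`, (103) `hH₁`, (75) `hΦd hΦ0 hΦ` with `S < r_Φ`, (44) `hCq hCd`,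
scaling `hι`, (46) `hH`, (54) `hq hRC`), the per-term sup bounds `hEb` on the flat ball `ball 0 r_E`, and the located
coupling `hcoupE : z̄ ≤ r_E∕2` — and NOTHING about supports, depths or located sums.  CONCLUSION — LITERALLY the END
hosts' `hElb₁` with `BE₁ := Σ_{i∈I} e i`: for every real chart point `‖y‖ ≤ S`,
`−(Σ_{i∈I} e i) ≤ (Σ_{i∈I} Ef i (toPiL (Z y))).re`, `Z y = landauExp C ι H (4C₂(ε₄+B₀b)²) (solAt 𝒢 0 W𝒱 ε₄ 0 (H₁ (Φ (cplx y)))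
+ H₁ (Φ (cplx y)))`.  Proof: (D)'s `rayData_chart` at `‖y‖ ≤ S` + `landauCurve_mapsTo` (radius `r_E∕2`) at `σ = 1 ∈ ball 0 (r_Φ∕S)`;
`‖toPiL ·‖ ≤ ‖·‖_pin`; §1.  Nothing of Bałaban's is asserted. [folklore] -/
theorem hElb_landau_chartRay_pinned (hδ' : 0 ≤ δ') (hϖ : ∀ b, 0 ≤ ϖ b) {S : ℝ} (hS : 0 < S)
    {𝒢 : 𝒵 →L[ℂ] WSup (pinW δ' ϖ) 1 𝔄} {W𝒱 : WSup (pinW δ' ϖ) 1 𝔄 → 𝒵} {B₀ C₄ a₃ : ℝ}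
    (h𝒢 : ∀ f, ‖𝒢 f‖ ≤ B₀ * ‖f‖) (hW : Prop4Hyp W𝒱 C₄ a₃) (hB₀ : 0 < B₀) (hC₄ : 0 ≤ C₄)
    {b ε₄ : ℝ} (hε₄ : 0 ≤ ε₄) (hdom : 2 * (ε₄ + B₀ * b) ≤ a₃)
    (hself : B₀ * C₄ * (ε₄ + B₀ * b) ^ 2 ≤ ε₄) (hcontr : 4 * B₀ * C₄ * (ε₄ + B₀ * b) < 1)
    (H₁ : ℬ →L[ℂ] WSup (pinW δ' ϖ) 1 𝔄) (hH₁ : ∀ B, ‖H₁ B‖ ≤ B₀ * ‖B‖)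
    {Φ : (Fin n → ℂ) → ℬ} {rΦ : ℝ} (hΦd : DifferentiableOn ℂ Φ (ball 0 rΦ)) (hΦ0 : Φ 0 = 0)
    (hΦ : ∀ z ∈ ball (0 : Fin n → ℂ) rΦ, ‖Φ z‖ < b) (hSr : S < rΦ)
    {C : 𝒴' → 𝒳} {C₂ R : ℝ} (hC₂ : 0 ≤ C₂) (hCq : ∀ Z : 𝒴', ‖Z‖ < R → ‖C Z‖ ≤ C₂ * ‖Z‖ ^ 2)
    (hCd : DifferentiableOn ℂ C (ball 0 R)) (ι : WSup (pinW δ' ϖ) 1 𝔄 →L[ℂ] 𝒴') (hι : ∀ Y, ‖ι Y‖ ≤ ‖Y‖)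
    (H : 𝒳 →L[ℂ] WSup (pinW δ' ϖ) 1 𝔄) (hH : ∀ X, ‖H X‖ ≤ B₀ * ‖X‖)
    (hq : 9 * C₂ * B₀ * (ε₄ + B₀ * b) < 1) (hRC : 3 * (ε₄ + B₀ * b) ≤ R)
    {𝔱 : Type*} (I : Finset 𝔱) {Ef : 𝔱 → (Λ → 𝔄) → ℂ} {rE : ℝ} {e : 𝔱 → ℝ}
    (hEb : ∀ i ∈ I, ∀ Z ∈ ball (0 : Λ → 𝔄) rE, ‖Ef i Z‖ ≤ e i)
    (hcoupE : (ε₄ + B₀ * b) + B₀ * (4 * C₂ * (ε₄ + B₀ * b) ^ 2) ≤ rE / 2) :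
    ∀ y : Fin n → ℝ, ‖y‖ ≤ S →
      -(∑ i ∈ I, e i) ≤ (∑ i ∈ I, Ef i (WSup.toPiL (pinW δ' ϖ) 1 (landauExp C ι H (4 * C₂ * (ε₄ + B₀ * b) ^ 2)
        (solAt 𝒢 0 W𝒱 ε₄ (0 : 𝒵) (H₁ (Φ (cplx y))) + H₁ (Φ (cplx y)))))).re := by
  haveI : CompleteSpace (WSup (pinW δ' ϖ) 1 𝔄) := completeSpace_wsup (pinW δ' ϖ) 1
  intro y hy
  -- the ray disc has radius `r_Φ∕S > 1`, so the parameter `σ = 1` is inside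
  have hRad1 : 1 < rΦ / S := by rw [lt_div_iff₀ hS]; linarith
  have hRad : 0 < rΦ / S := one_pos.trans hRad1
  have h1 : (1 : ℂ) ∈ ball (0 : ℂ) (rΦ / S) := by rw [mem_ball_zero_iff, norm_one]; exact hRad1
  -- (D)'s chart-ray data at `‖y‖ ≤ S` and the curve's range in the PINNED ball of radius `r_E∕2`
  have hΛ : ∀ Y : WSup (pinW δ' ϖ) 1 𝔄, ‖(0 : WSup (pinW δ' ϖ) 1 𝔄 →L[ℂ] WSup (pinW δ' ϖ) 1 𝔄) Y‖ ≤ 0 * ‖Y‖ :=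
    fun Y => by simp
  have hself' : B₀ * 0 + 0 * (ε₄ + B₀ * b) + B₀ * C₄ * (ε₄ + B₀ * b) ^ 2 ≤ ε₄ := by simpa using hself
  have hcontr' : 0 + 4 * B₀ * C₄ * (ε₄ + B₀ * b) < 1 := by simpa using hcontr
  have hray := rayData_chart H₁ hH₁ hB₀ hΦd hΦ0 hΦ hS hy
  have hmaps := landauCurve_mapsTo h𝒢 hΛ hW hB₀.le hC₄ le_rfl hε₄ hdom hself' hcontr' hRad
    (currentData_zero (𝒵 := 𝒵) (rΦ / S)).1 hray.1 (currentData_zero (𝒵 := 𝒵) (rΦ / S)).2.1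
    hray.2.2.1 rfl hray.2.1 hC₂ hCq hCd ι hι H hH hq hRC hcoupE
  -- at `σ = 1`: the exponent field at the chart point, its FLAT image in `ball 0 r_E`
  have hpt := hmaps h1
  simp only [one_smul] at hpt
  rw [mem_ball_zero_iff] at hpt
  have hflat : WSup.toPiL (pinW δ' ϖ) 1 (landauExp C ι H (4 * C₂ * (ε₄ + B₀ * b) ^ 2)
      (solAt 𝒢 0 W𝒱 ε₄ (0 : 𝒵) (H₁ (Φ (cplx y))) + H₁ (Φ (cplx y)))) ∈ ball (0 : Λ → 𝔄) rE := by
    rw [mem_ball_zero_iff]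
    have h0 : (0 : ℝ) < rE / 2 := (norm_nonneg _).trans_lt hpt
    exact (norm_toPiL_le_of_nonneg hδ' hϖ _).trans_lt (hpt.trans (by linarith))
  exact re_sum_ge_neg_sum_of_mem_ball I hEb hflat

/-- **THE LINEAR-CHART FORM** (the hosts of record S104 f2∕f4, THE ONE CALL v3∕v4: `Φe := ⇑(Te V)` a continuous LINEAR
map with the number junction `hTbe : ‖Te V‖·r_Φe < be`, R10 supplied): the same conclusion, the three analytic `Φ`-binders
discharged in-line (`(T V).differentiable`, `map_zero`, `‖T z‖ ≤ ‖T‖‖z‖ < b` on the ball — S104 f1a's three facts, re-proved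
here to keep the import list at S71 f2). V-indexed, as the hosts call it. [folklore] -/
theorem hElb_landau_chartRay_pinned_linear {𝒱 : Type*} (hδ' : 0 ≤ δ') (hϖ : ∀ b, 0 ≤ ϖ b) {S : ℝ} (hS : 0 < S)
    {𝒢 : 𝒱 → (𝒵 →L[ℂ] WSup (pinW δ' ϖ) 1 𝔄)} {W𝒱 : 𝒱 → WSup (pinW δ' ϖ) 1 𝔄 → 𝒵} {B₀ C₄ a₃ : ℝ}
    (h𝒢 : ∀ V f, ‖𝒢 V f‖ ≤ B₀ * ‖f‖) (hW : ∀ V, Prop4Hyp (W𝒱 V) C₄ a₃) (hB₀ : 0 < B₀) (hC₄ : 0 ≤ C₄)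
    {b ε₄ : ℝ} (hε₄ : 0 ≤ ε₄) (hdom : 2 * (ε₄ + B₀ * b) ≤ a₃)
    (hself : B₀ * C₄ * (ε₄ + B₀ * b) ^ 2 ≤ ε₄) (hcontr : 4 * B₀ * C₄ * (ε₄ + B₀ * b) < 1)
    (H₁ : 𝒱 → (ℬ →L[ℂ] WSup (pinW δ' ϖ) 1 𝔄)) (hH₁ : ∀ V B, ‖H₁ V B‖ ≤ B₀ * ‖B‖)
    (T : 𝒱 → ((Fin n → ℂ) →L[ℂ] ℬ)) {rΦ : ℝ} (hTb : ∀ V, ‖T V‖ * rΦ < b) (hSr : S < rΦ)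
    {C : 𝒱 → 𝒴' → 𝒳} {C₂ R : ℝ} (hC₂ : 0 ≤ C₂) (hCq : ∀ V, ∀ Z : 𝒴', ‖Z‖ < R → ‖C V Z‖ ≤ C₂ * ‖Z‖ ^ 2)
    (hCd : ∀ V, DifferentiableOn ℂ (C V) (ball 0 R)) (ι : 𝒱 → (WSup (pinW δ' ϖ) 1 𝔄 →L[ℂ] 𝒴'))
    (hι : ∀ V Y, ‖ι V Y‖ ≤ ‖Y‖) (H : 𝒱 → (𝒳 →L[ℂ] WSup (pinW δ' ϖ) 1 𝔄)) (hH : ∀ V X, ‖H V X‖ ≤ B₀ * ‖X‖)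
    (hq : 9 * C₂ * B₀ * (ε₄ + B₀ * b) < 1) (hRC : 3 * (ε₄ + B₀ * b) ≤ R)
    {𝔱 : Type*} (I : Finset 𝔱) {Ef : 𝔱 → (Λ → 𝔄) → ℂ} {rE : ℝ} {e : 𝔱 → ℝ}
    (hEb : ∀ i ∈ I, ∀ Z ∈ ball (0 : Λ → 𝔄) rE, ‖Ef i Z‖ ≤ e i)
    (hcoupE : (ε₄ + B₀ * b) + B₀ * (4 * C₂ * (ε₄ + B₀ * b) ^ 2) ≤ rE / 2) :
    ∀ V (y : Fin n → ℝ), ‖y‖ ≤ S →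
      -(∑ i ∈ I, e i) ≤ (∑ i ∈ I, Ef i (WSup.toPiL (pinW δ' ϖ) 1 (landauExp (C V) (ι V) (H V)
        (4 * C₂ * (ε₄ + B₀ * b) ^ 2)
        (solAt (𝒢 V) 0 (W𝒱 V) ε₄ (0 : 𝒵) (H₁ V (T V (cplx y))) + H₁ V (T V (cplx y)))))).re := fun V =>
  hElb_landau_chartRay_pinned hδ' hϖ hS (h𝒢 V) (hW V) hB₀ hC₄ hε₄ hdom hself hcontr (H₁ V) (hH₁ V)
    (Φ := ⇑(T V)) (T V).differentiable.differentiableOn (map_zero (T V))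
    (fun z hz => ((T V).le_opNorm z).trans_lt
      ((mul_le_mul_of_nonneg_left (mem_ball_zero_iff.1 hz).le (norm_nonneg _)).trans_lt (hTb V)))
    hSr hC₂ (hCq V) (hCd V) (ι V) (hι V) (H V) (hH V) hq hRC I hEb hcoupE

omit [NormedSpace ℂ 𝔄] [CompleteSpace 𝔄] [CompleteSpace 𝒳] in
/-- `0 ≤ Σ_{i∈I} e_i` — from `hEb` at the centre of the ball (`0 < r_E`); the defined `BE₁` is nonnegative. [folklore] -/
theorem hElb_landau_chartRay_pinned_nonneg {𝔱 : Type*} (I : Finset 𝔱) {Ef : 𝔱 → (Λ → 𝔄) → ℂ} {rE : ℝ}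
    {e : 𝔱 → ℝ} (hrE : 0 < rE) (hEb : ∀ i ∈ I, ∀ Z ∈ ball (0 : Λ → 𝔄) rE, ‖Ef i Z‖ ≤ e i) :
    0 ≤ ∑ i ∈ I, e i :=
  Finset.sum_nonneg fun i hi => (norm_nonneg _).trans (hEb i hi 0 (mem_ball_self hrE))

end ChartRay

end Summit.QuantumFields.BalabanUV.T4Continuum.ShellMeasureRayTermsPinnedLower

end
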